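import Literature.AlgebraicGeometry.HodgeTheory.KaehlerClass
import Literature.AlgebraicGeometry.HodgeTheory.HodgeTypePullbackVanishing
import Literature.Geometry.Kaehler.ManifoldFormsPullback
import Literature.NumberTheory.Transcendental.ComplexFormsPullback
import HarnessLib

/-!
# `c·H + φ^*H` is a Kähler class for `H` Kähler, `c > 0` and `φ : X ⟶ X` (pull-backs of Kähler forms along holomorphic maps are semipositive)

Family `hodge`, layer `Literature/AlgebraicGeometry/HodgeTheory`, companion of `KaehlerClass`
(`HodgeModel.IsKaehlerClassVia A e H`: `A^* H = e[ω_g] ⊗ 1` for a Kähler metric `g` on the Hodge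
model `A` — the Kähler cone of `(A, e)`, convex by `IsKaehlerClassVia.add/smul_of_pos`). Printed
content: for a holomorphic map `f : Y → X` and a Kähler form `ω` on `X`, `f^*ω` is a closed real
`(1,1)`-form which is SEMIPOSITIVE, `f^*ω(v, Jv) = ω(df v, J df v) = g(df v, df v) ≥ 0` (`df` is
`ℂ`-linear), so `c ω' + f^*ω` is a Kähler form for every Kähler form `ω'` on `Y` and `c > 0`
(Voisin I §3.1.1 Lemma 3.3, §3.1.2 Def. 3.6; this is how one sees that `π₁^*ω₁ + π₂^*ω₂` and the
pull-back of an ample class plus an ample class are Kähler, cf. Voisin I §3.1.3). On the carriers: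

* `kaehlerForm_pullback_tangentJ_tangentJ`, `kaehlerForm_pullback_self_tangentJ_nonneg` — `f^*ω_g`
  is `J`-invariant and semipositive for `f` holomorphic (`mfderiv_real_apply_smul`);
* `exists_isKaehler_kaehlerForm_eq_smul_add_pullback` — `c ω_g + f^*ω_g` (`c > 0`, `f : M → M`
  holomorphic) is the Kähler form of a Kähler metric (`exists_isKaehler_kaehlerForm_eq_of_closed_positive_form`);
* `HodgeModel.IsKaehlerClassVia.smul_add_map` — **for `X` smooth projective, `φ : X ⟶ X`, `H` a
  Kähler class of `(A, e)` with `e` natural, and `c > 0`, the class `c • H + φ^* H` is a Kähler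
  class of `(A, e)`**: `A^*(φ^* H) = (φ^an)^* A^* H = e[(φ^an)^* ω_g] ⊗ 1` by the naturality of
  `A^*` (`HodgeModel.map_anMap_pullback`, GAGA §2 n°5: `φ^an` is holomorphic,
  `HodgeModel.mdifferentiable_anMap`), of `e` and of `⊗ 1` (`ofRealClass_map`);
* `HodgeModel.IsKaehlerClassVia.nsmul_add_map` — the spelling `(d : ℂ) • H + φ^*H`, `d ≥ 1` a
  natural number (the polarization-type classes `d·θ + φ^*θ` of abelian varieties of Weil type,
  `Motives/HyperbolicWeilType`, `Motives/AimedSplitProduct`).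

No definition and no named fact is introduced (D-0026).

## References

* [VoisinHodgeI2002] C. Voisin, Hodge Theory and Complex Algebraic Geometry I (CUP 2002), §3.1.1
  Lemma 3.3, §3.1.2 Def. 3.6, §3.1.3, §7.3.2.
* [SerreGAGA1956] J.-P. Serre, GAGA, Ann. Inst. Fourier 6 (1956), §2 n°5.
-/

noncomputable section

open scoped Manifold ContDiff
open CategoryTheory Bundle Module
open Literature.AlgebraicTopology.SingularHomology
open Literature.Geometry.Kaehler
open Literature.NumberTheory.Transcendental (DeRhamIsoFamily isSmoothForm_pullback mextDeriv_pullback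
  mfderiv_real_apply_smul)

-- The identification `TangentSpace I x = E` is an abuse of definitional equality; as in the tree's
-- tangent-bundle files we let `isDefEq` unfold it.
set_option backward.isDefEq.respectTransparency false

namespace Literature.AlgebraicGeometry.HodgeTheory

section HodgeTheory

/-! ### Pull-backs of Kähler forms along holomorphic maps -/

section Forms

variable {E : Type*} [NormedAddCommGroup E] [NormedSpace ℂ E]
  {M : Type*} [TopologicalSpace M] [ChartedSpace E M]
  {N : Type*} [TopologicalSpace N] [ChartedSpace E N]

/-- The real differential of a holomorphic map commutes with `J`: `df (Jv) = J (df v)`.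
[cite: VoisinHodgeI2002, §2.2.1] -/
theorem mfderiv_tangentJ {f : N → M} {x : N} (hf : MDifferentiableAt 𝓘(ℂ, E) 𝓘(ℂ, E) f x)
    (v : TangentSpace 𝓘(ℝ, E) x) :
    mfderiv 𝓘(ℝ, E) 𝓘(ℝ, E) f x (tangentJ E x v) = tangentJ E (f x) (mfderiv 𝓘(ℝ, E) 𝓘(ℝ, E) f x v) :=
  mfderiv_real_apply_smul hf Complex.I v

/-- **`f^*ω_g` is `J`-invariant** for `g` Hermitian and `f` holomorphic:
`(f^*ω)(Jv, Jw) = ω(J df v, J df w) = ω(df v, df w)`. [cite: VoisinHodgeI2002, §3.1.1 Lemma 3.3 and §7.3.2] -/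
theorem kaehlerForm_pullback_tangentJ_tangentJ (g : RiemannianMetric (fun x : M ↦ TangentSpace 𝓘(ℝ, E) x))
    (hg : g.IsHermitian) {f : N → M} (hf : MDifferentiable 𝓘(ℂ, E) 𝓘(ℂ, E) f) (x : N)
    (v w : TangentSpace 𝓘(ℝ, E) x) :
    (g.kaehlerForm.pullback 𝓘(ℝ, E) f) x ![tangentJ E x v, tangentJ E x w] =
      (g.kaehlerForm.pullback 𝓘(ℝ, E) f) x ![v, w] := by
  rw [MForm.pullback_apply, MForm.pullback_apply]
  have h1 : (fun i ↦ mfderiv 𝓘(ℝ, E) 𝓘(ℝ, E) f x (![tangentJ E x v, tangentJ E x w] i)) =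
      ![tangentJ E (f x) (mfderiv 𝓘(ℝ, E) 𝓘(ℝ, E) f x v),
        tangentJ E (f x) (mfderiv 𝓘(ℝ, E) 𝓘(ℝ, E) f x w)] := by
    ext i; fin_cases i
    · exact mfderiv_tangentJ (hf x) v
    · exact mfderiv_tangentJ (hf x) w
  have h2 : (fun i ↦ mfderiv 𝓘(ℝ, E) 𝓘(ℝ, E) f x (![v, w] i)) =
      ![mfderiv 𝓘(ℝ, E) 𝓘(ℝ, E) f x v, mfderiv 𝓘(ℝ, E) 𝓘(ℝ, E) f x w] := by
    ext i; fin_cases i <;> rfl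
  rw [h1, h2, hg.kaehlerForm_tangentJ_tangentJ]

/-- **`f^*ω_g` is semipositive** for `g` Hermitian and `f` holomorphic:
`(f^*ω)(v, Jv) = ω(df v, J df v) = g(df v, df v) ≥ 0`. [cite: VoisinHodgeI2002, §3.1.1 Lemma 3.3] -/
theorem kaehlerForm_pullback_self_tangentJ_nonneg (g : RiemannianMetric (fun x : M ↦ TangentSpace 𝓘(ℝ, E) x))
    (hg : g.IsHermitian) {f : N → M} (hf : MDifferentiable 𝓘(ℂ, E) 𝓘(ℂ, E) f) (x : N)
    (v : TangentSpace 𝓘(ℝ, E) x) :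
    0 ≤ (g.kaehlerForm.pullback 𝓘(ℝ, E) f) x ![v, tangentJ E x v] := by
  rw [MForm.pullback_apply]
  have h2 : (fun i ↦ mfderiv 𝓘(ℝ, E) 𝓘(ℝ, E) f x (![v, tangentJ E x v] i)) =
      ![mfderiv 𝓘(ℝ, E) 𝓘(ℝ, E) f x v, tangentJ E (f x) (mfderiv 𝓘(ℝ, E) 𝓘(ℝ, E) f x v)] := by
    ext i; fin_cases i
    · rfl
    · exact mfderiv_tangentJ (hf x) v
  rw [h2]
  by_cases hv : mfderiv 𝓘(ℝ, E) 𝓘(ℝ, E) f x v = 0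
  · rw [hv, map_zero]
    have : (![0, 0] : Fin 2 → TangentSpace 𝓘(ℝ, E) (f x)) = 0 := by
      ext i; fin_cases i <;> rfl
    rw [this, (g.kaehlerForm (f x)).map_zero]
  · exact (kaehlerForm_self_tangentJ_pos g hg (f x) _ hv).le

variable [FiniteDimensional ℂ E] [IsManifold 𝓘(ℂ, E) ω M] [IsManifold 𝓘(ℝ, E) ∞ M]

/-- **`c ω_g + f^*ω_g` is a Kähler form** for a smooth Kähler metric `g`, `c > 0` and a holomorphic
`f : M → M`: it is smooth, closed (`d f^* = f^* d`), `J`-invariant and positive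
(`ω(v, Jv) > 0`, `f^*ω(v, Jv) ≥ 0`), hence the Kähler form of a Kähler metric
(`exists_isKaehler_kaehlerForm_eq_of_closed_positive_form`). [cite: VoisinHodgeI2002, §3.1.1 Lemma 3.3 and §3.1.2 Def. 3.6] -/
theorem exists_isKaehler_kaehlerForm_eq_smul_add_pullback {c : ℝ} (hc : 0 < c)
    (g : ContMDiffRiemannianMetric 𝓘(ℝ, E) ∞ E (fun x : M ↦ TangentSpace 𝓘(ℝ, E) x))
    (hg : g.toRiemannianMetric.IsKaehler) {f : M → M} (hf : MDifferentiable 𝓘(ℂ, E) 𝓘(ℂ, E) f)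
    (hfs : ContMDiff 𝓘(ℝ, E) 𝓘(ℝ, E) ∞ f) :
    ∃ g' : ContMDiffRiemannianMetric 𝓘(ℝ, E) ∞ E (fun x : M ↦ TangentSpace 𝓘(ℝ, E) x),
      g'.toRiemannianMetric.IsKaehler ∧
        g'.toRiemannianMetric.kaehlerForm =
          c • g.toRiemannianMetric.kaehlerForm + g.toRiemannianMetric.kaehlerForm.pullback 𝓘(ℝ, E) f := by
  have hω := isSmoothForm_kaehlerForm_of_isManifold_complex_holds (E := E) (M := M)
  have hs : IsSmoothForm (g.toRiemannianMetric.kaehlerForm.pullback 𝓘(ℝ, E) f) :=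
    isSmoothForm_pullback hfs (hω g)
  refine exists_isKaehler_kaehlerForm_eq_of_closed_positive_form _ (((hω g).smul c).add hs) ?_ ?_ ?_
  · change mextDeriv _ = 0
    rw [mextDeriv_add ((hω g).smul c) hs, mextDeriv_smul, mextDeriv_pullback hfs (hω g),
      hg.isClosedForm_kaehlerForm, smul_zero, MForm.pullback_zero, add_zero]
  · intro x v w
    change c • g.toRiemannianMetric.kaehlerForm x _ + (g.toRiemannianMetric.kaehlerForm.pullback 𝓘(ℝ, E) f) x _ =
      c • g.toRiemannianMetric.kaehlerForm x _ + (g.toRiemannianMetric.kaehlerForm.pullback 𝓘(ℝ, E) f) x _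
    rw [hg.isHermitian.kaehlerForm_tangentJ_tangentJ,
      kaehlerForm_pullback_tangentJ_tangentJ _ hg.isHermitian hf]
  · intro x v hv
    change 0 < c • g.toRiemannianMetric.kaehlerForm x _ + (g.toRiemannianMetric.kaehlerForm.pullback 𝓘(ℝ, E) f) x _
    exact add_pos_of_pos_of_nonneg (smul_pos hc (kaehlerForm_self_tangentJ_pos _ hg.isHermitian x v hv))
      (kaehlerForm_pullback_self_tangentJ_nonneg _ hg.isHermitian hf x v)

/-- Kähler classes of `c ω_g + f^*ω_g`: `[ω_{g'}] = c [ω_g] + f^*[ω_g]` in `H²_dR(M; ℝ)`.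
[cite: VoisinHodgeI2002, §3.1.3] -/
theorem kaehlerClass_eq_smul_add_map_of_kaehlerForm_eq [T2Space M] [SigmaCompactSpace M]
    (hω : isSmoothForm_kaehlerForm_of_isManifold_complex (E := E) (M := M)) {c : ℝ}
    {g g' : ContMDiffRiemannianMetric 𝓘(ℝ, E) ∞ E (fun x : M ↦ TangentSpace 𝓘(ℝ, E) x)}
    (hg : g.toRiemannianMetric.IsKaehler) (hg' : g'.toRiemannianMetric.IsKaehler) {f : M → M}
    (hfs : ContMDiff 𝓘(ℝ, E) 𝓘(ℝ, E) ∞ f)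
    (h : g'.toRiemannianMetric.kaehlerForm =
      c • g.toRiemannianMetric.kaehlerForm + g.toRiemannianMetric.kaehlerForm.pullback 𝓘(ℝ, E) f) :
    g'.kaehlerClass hω hg' = c • g.kaehlerClass hω hg + deRhamCohomology.map hfs 2 (g.kaehlerClass hω hg) := by
  unfold ContMDiffRiemannianMetric.kaehlerClass
  rw [deRhamCohomology.map_mk, ← map_smul, ← map_add]
  congr 1
  exact Subtype.ext h

end Forms

/-! ### The Kähler cone of `(A, e)` is stable under `H ↦ c • H + φ^* H` -/

section HodgeModels

variable {n : ℕ} {X : Motives.SchemeOver ℂ}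

/-- **`c • H + φ^* H` is a Kähler class of `(A, e)`** for `H` a Kähler class of `(A, e)`, `e`
natural, `X` smooth projective, `φ : X ⟶ X` and `c > 0`: with `A^* H = e[ω_g] ⊗ 1`,
`A^*(c H + φ^* H) = c · e[ω_g] ⊗ 1 + (φ^an)^*(e[ω_g] ⊗ 1) = e[c ω_g + (φ^an)^*ω_g] ⊗ 1`
(`HodgeModel.map_anMap_pullback`; naturality of `e` along the holomorphic, hence `C^∞`, map
`φ^an = HodgeModel.anMap A A φ`; `ofRealClass_map`), and `c ω_g + (φ^an)^*ω_g` is a Kähler form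
(`exists_isKaehler_kaehlerForm_eq_smul_add_pullback`).
[cite: VoisinHodgeI2002, §3.1.1 Lemma 3.3, §3.1.3 and §7.3.2] [cite: SerreGAGA1956, §2 n°5] -/
theorem HodgeModel.IsKaehlerClassVia.smul_add_map {A : HodgeModel n X} {e : DeRhamIsoFamily 𝓘(ℝ, A.model)}
    (he : e.IsNatural) (hX : Motives.IsSmoothProjective n X) (φ : X ⟶ X) {H : complexBetti X 2}
    (hH : A.IsKaehlerClassVia e H) {c : ℝ} (hc : 0 < c) :
    A.IsKaehlerClassVia e ((c : ℂ) • H + complexBetti.map φ 2 H) := by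
  obtain ⟨g, hg, hHg⟩ := hH
  have hf : MDifferentiable 𝓘(ℂ, A.model) 𝓘(ℂ, A.model) (HodgeModel.anMap A A φ) :=
    HodgeModel.mdifferentiable_anMap A A φ hX hX
  have hfs : ContMDiff 𝓘(ℝ, A.model) 𝓘(ℝ, A.model) ∞ (HodgeModel.anMap A A φ) :=
    HodgeModel.contMDiff_anMap A A φ hX hX
  obtain ⟨g', hg', hform⟩ := exists_isKaehler_kaehlerForm_eq_smul_add_pullback hc g hg hf hfs
  have hω := isSmoothForm_kaehlerForm_of_isManifold_complex_holds (E := A.model) (M := A.carrier)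
  refine ⟨g', hg', ?_⟩
  have hpull : A.pullback 2 (complexBetti.map φ 2 H) =
      singularCohomology.map ℂ ℂ ⟨HodgeModel.anMap A A φ, HodgeModel.continuous_anMap A A φ⟩ 2
        (A.pullback 2 H) :=
    (HodgeModel.map_anMap_pullback A A φ 2 H).symm
  rw [map_add, map_smul, hpull, hHg, ← ofRealClass_smul, ← ofRealClass_map,
    ← he A.carrier A.carrier (HodgeModel.anMap A A φ) hfs 2, ← map_add, ← LinearEquiv.map_smul,
    ← map_add, ← kaehlerClass_eq_smul_add_map_of_kaehlerForm_eq hω hg hg' hfs hform]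

/-- The spelling met by polarization-type classes of abelian varieties of Weil type:
**`(d : ℂ) • H + φ^* H` is a Kähler class of `(A, e)`** for a natural number `d ≥ 1`.
[cite: VoisinHodgeI2002, §3.1.3 and §7.1.2] -/
theorem HodgeModel.IsKaehlerClassVia.natCast_smul_add_map {A : HodgeModel n X}
    {e : DeRhamIsoFamily 𝓘(ℝ, A.model)} (he : e.IsNatural) (hX : Motives.IsSmoothProjective n X)
    (φ : X ⟶ X) {H : complexBetti X 2} (hH : A.IsKaehlerClassVia e H) {d : ℕ} (hd : 0 < d) :
    A.IsKaehlerClassVia e ((d : ℂ) • H + complexBetti.map φ 2 H) := by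
  have h := hH.smul_add_map he hX φ (c := (d : ℝ)) (by exact_mod_cast hd)
  rwa [Complex.ofReal_natCast] at h

/-- Model-free form: **`c • H + φ^* H` is a Kähler class** (`IsKaehlerClass`) for `H` Kähler.
[cite: VoisinHodgeI2002, §3.1.3 and §7.3.2] -/
theorem IsKaehlerClass.smul_add_map (hX : Motives.IsSmoothProjective n X) (φ : X ⟶ X)
    {H : complexBetti X 2} (hH : IsKaehlerClass n X H) {c : ℝ} (hc : 0 < c) :
    IsKaehlerClass n X ((c : ℂ) • H + complexBetti.map φ 2 H) := by
  obtain ⟨A, e, he, hem, hH⟩ := (isKaehlerClass_iff H).1 hH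
  exact (hH.smul_add_map he hX φ hc).isKaehlerClass he hem

end HodgeModels

end HodgeTheory

end Literature.AlgebraicGeometry.HodgeTheory

end
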